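import Summits.BirchSwinnertonDyer.BirchSwinnertonDyer.Theses.UniversalToricDescent
import Summits.BirchSwinnertonDyer.BirchSwinnertonDyer.Theorems.WildThreeInclusionFlatToUnrDescent
import Literature.NumberTheory.EllipticCurves.IwasawaAlgebra
import HarnessLib

/-!
# UTD's wall crux 20395 `AdditiveSplitIMCInclusionAtThree` follows from its ♭-typed form at EVERY frame —
# NO control theorem needed (`Ch_Λ(X)` is principal for ANY `Λ`-module); the composition of the ♭ line
# (cell `bsd-wall`, D-0131 (3) M-UTD, seat `bsd-wall-utd-p3` gen 3; `--supports stmt-BirchSwinnertonDyer-20395`)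

Gen 2 of this seat proved (`Theorems/WildThreeInclusionFlatToUnrDescent.lean`, p559816/p561974) that the
♭-typed inclusion `(Q) ⊆ Ch_Λ(X_(∅,0))·𝓞_{ℂ_p}⟦T⟧` for every ♭-frame `Q` implies the `R₀`-typed text of
record `(L) ⊆ Ch_Λ(X_(∅,0))·R₀⟦T⟧` for every `R₀`-frame `L` — AT A CONTROL FRAME
(`XAc.HasCharValuationAt … n`), which was used only to know that `Ch_Λ(X)` is principal. But the
characteristic ideal of ANY module over `Λ = ℤ_p⟦T⟧` is principal (`Λ` is a UFD; Washington §13.2 — the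
tree THEOREM `Literature.NumberTheory.EllipticCurves.charIdeal_isPrincipal_holds`, Mathlib-only proof). So:

* §1 `exists_xacCharIdeal_eq_span` — `∃ g, Ch_Λ(X_ac^S(E/K_∞)) = (g)` for every datum, unconditionally;
  `unrInclGe_of_flatInclGe'` / `unrInclLe_of_flatInclLe'` / `unrEq_of_flatEq'` — gen 2's three transfers
  with the control hypothesis REMOVED (UTD 20395 / SOED 20479 / UTD 20186 conclusion shapes).
* §2 **`additiveSplitIMCInclusionAtThree_of_flat`** — the crux `AdditiveSplitIMCInclusionAtThree` BY NAME
  from its ♭ form with THE SAME binders (the displayed hypothesis `hflat` = the registered stub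
  `stub_flatInclusion` of line `flat` on 20395, text below VERBATIM): the composition of that line is this
  one `exact`. Also `additiveSplitIMCInclusionAtThree_of_flat_weak` — from the WEAKER-bindered ♭ text of gen 2's
  TURNKEY (`ClassO5 ∨ ClassO6`, `ρ̄₃` irreducible, `r_an ≤ 1`; evidence #3 on 20395), which implies the stub.

HONEST FRAMING: pure transport (`R₀ ⊆ 𝓞_{ℂ_p}` + principality); the research content — ONE inclusion of the
(∅,0) anticyclotomic main conjecture at the additive split prime 3 for `E` itself (Howard/Kolyvagin
direction; barrier `TraceZeroHeegnerTowerAtAdditiveSplitP` on its natural technique) — is the displayed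
hypothesis, untouched. Closes nothing by itself. BSD is not proved for any curve by this file. No definition,
no named fact, no `sorry`.

References: [Washington1997] §13.2 (after Thm. 13.12); [Castella2018] §3 (arXiv:1704.06608 p. 9);
[Hsieh2014] Thm. A (arXiv:1112.1580 p. 3) — the ♭ receptacle `Z̄_p⟦Γ⁻⟧ ⊆ 𝓞_{ℂ_p}⟦T⟧`.
-/

noncomputable section

open scoped Classical

set_option linter.dupNamespace false
set_option autoImplicit false

namespace Summit.BirchSwinnertonDyer.BirchSwinnertonDyer.Theorems.WildThreeInclusionKernel

open PowerSeries NumberField IsDedekindDomain Literature.NumberTheory.EllipticCurves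
  Summit.BirchSwinnertonDyer.Rank1Residual.X11b
  Summit.BirchSwinnertonDyer.Rank1Residual.X11b.Halves
  Summit.BirchSwinnertonDyer.Rank1Residual.X11b.AcSelmer

variable {p : ℕ} [Fact p.Prime]

/-! ### §1 Principality is free; the three ♭ ⟹ `R₀` transfers without control -/

section Frame

variable {K : Type} [Field K] [NumberField K] {N : ℕ} (W : WeierstrassCurve ℚ)
  (κ : ZpExtension K p) (𝔭' : HeightOneSpectrum (𝓞 K)) (S : Set (HeightOneSpectrum (𝓞 K)))
  (γ : Field.absoluteGaloisGroup K) [Fact (κ.IsTopGenerator γ)]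

/-- **`Ch_Λ(X_ac^S(E/K_∞))` is principal, unconditionally** (no torsion, no control): the characteristic
ideal of any `Λ`-module is a finite (or empty) product of powers of height-one primes of the UFD
`Λ = ℤ_p⟦T⟧`, each principal (tree theorem `charIdeal_isPrincipal_holds`). [cite: Washington1997, §13.2] -/
theorem exists_xacCharIdeal_eq_span :
    ∃ g : IwasawaAlgebra p, XAc.charIdeal (W.baseChange K) p κ 𝔭' S γ = Ideal.span {g} :=
  (charIdeal_isPrincipal_holds p (XAc (W.baseChange K) p κ 𝔭' S γ)).principal

/-- **UTD 20395's conclusion shape from its ♭ form, at EVERY frame (no control).** IF every ♭-frame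
`Q ∈ 𝓞_{ℂ_p}⟦T⟧` of `(ι′, 𝔭, f, Ω_K, Ω_p)` satisfies `(Q) ⊆ Ch·𝓞_{ℂ_p}⟦T⟧`, THEN every `R₀`-frame `L`
satisfies `(L) ⊆ Ch·R₀⟦T⟧`: `L^♭` is a ♭-frame (`R1.isBDPLFunctionInt_map`), `Ch` is principal (§1), and
divisibility descends from `𝓞_{ℂ_p}⟦T⟧` to `R₀⟦T⟧` (gen 2's `span_le_map_toUnr_of_flat`). [folklore]
[cite: Castella2018, §3 (arXiv:1704.06608 p. 9)] -/
theorem unrInclGe_of_flatInclGe'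
    {ι' : PadicAlgCl p ≃+* ℂ} {𝔭 : HeightOneSpectrum (𝓞 K)} {f : CuspForm (CongruenceSubgroup.Gamma0 N) 2}
    {ΩK : ℂ} {Ωp : ℂ_[p]}
    (hflat : ∀ Q : PowerSeries 𝓞_ℂ_[p], R1.IsBDPLFunctionInt p ι' 𝔭 κ γ f ΩK Ωp Q →
      Ideal.span {Q} ≤ (XAc.charIdeal (W.baseChange K) p κ 𝔭' S γ).map (PowerSeries.map (R1.toCpInt p)))
    (L : UnrSeries p) (hL : IsBDPLFunction ι' 𝔭 κ γ f ΩK Ωp L) :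
    Ideal.span {L} ≤ (XAc.charIdeal (W.baseChange K) p κ 𝔭' S γ).map (PowerSeries.map (toUnr p)) :=
  span_le_map_toUnr_of_flat (exists_xacCharIdeal_eq_span W κ 𝔭' S γ)
    (hflat _ (R1.isBDPLFunctionInt_map hL))

/-- **SOED 20479's conclusion shape from its ♭ form, at EVERY frame (no control)**: IF every ♭-frame `Q`
satisfies `Ch·𝓞_{ℂ_p}⟦T⟧ ⊆ (Q)`, THEN every `R₀`-frame `L` satisfies `Ch·R₀⟦T⟧ ⊆ (L)`. [folklore]
[cite: Castella2018, §3 (arXiv:1704.06608 p. 9)] -/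
theorem unrInclLe_of_flatInclLe'
    {ι' : PadicAlgCl p ≃+* ℂ} {𝔭 : HeightOneSpectrum (𝓞 K)} {f : CuspForm (CongruenceSubgroup.Gamma0 N) 2}
    {ΩK : ℂ} {Ωp : ℂ_[p]}
    (hflat : ∀ Q : PowerSeries 𝓞_ℂ_[p], R1.IsBDPLFunctionInt p ι' 𝔭 κ γ f ΩK Ωp Q →
      (XAc.charIdeal (W.baseChange K) p κ 𝔭' S γ).map (PowerSeries.map (R1.toCpInt p)) ≤ Ideal.span {Q})
    (L : UnrSeries p) (hL : IsBDPLFunction ι' 𝔭 κ γ f ΩK Ωp L) :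
    (XAc.charIdeal (W.baseChange K) p κ 𝔭' S γ).map (PowerSeries.map (toUnr p)) ≤ Ideal.span {L} :=
  map_toUnr_le_span_of_flat (exists_xacCharIdeal_eq_span W κ 𝔭' S γ)
    (hflat _ (R1.isBDPLFunctionInt_map hL))

/-- **Equality descends at EVERY frame (no control)**: ♭-equality `Ch·𝓞_{ℂ_p}⟦T⟧ = (Q)` for every ♭-frame ⟹
`R₀`-equality `Ch·R₀⟦T⟧ = (L)` for every `R₀`-frame (UTD 20186's conclusion shape). [folklore]
[cite: Castella2018, §3 (arXiv:1704.06608 p. 9)] -/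
theorem unrEq_of_flatEq'
    {ι' : PadicAlgCl p ≃+* ℂ} {𝔭 : HeightOneSpectrum (𝓞 K)} {f : CuspForm (CongruenceSubgroup.Gamma0 N) 2}
    {ΩK : ℂ} {Ωp : ℂ_[p]}
    (hflat : ∀ Q : PowerSeries 𝓞_ℂ_[p], R1.IsBDPLFunctionInt p ι' 𝔭 κ γ f ΩK Ωp Q →
      (XAc.charIdeal (W.baseChange K) p κ 𝔭' S γ).map (PowerSeries.map (R1.toCpInt p)) = Ideal.span {Q})
    (L : UnrSeries p) (hL : IsBDPLFunction ι' 𝔭 κ γ f ΩK Ωp L) :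
    (XAc.charIdeal (W.baseChange K) p κ 𝔭' S γ).map (PowerSeries.map (toUnr p)) = Ideal.span {L} :=
  le_antisymm (unrInclLe_of_flatInclLe' W κ 𝔭' S γ (fun Q hQ ↦ (hflat Q hQ).le) L hL)
    (unrInclGe_of_flatInclGe' W κ 𝔭' S γ (fun Q hQ ↦ (hflat Q hQ).ge) L hL)

end Frame

/-! ### §2 The crux BY NAME from its ♭ form (the composition of line `flat` on 20395) -/

open Summit.BirchSwinnertonDyer.BirchSwinnertonDyer.Theses.UniversalToricDescent

/-- **`AdditiveSplitIMCInclusionAtThree` ⟸ its ♭-typed form with the same binders.** The displayed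
hypothesis `hflat` is, VERBATIM, the registered stub `stub_flatInclusion` of line `flat` on item 20395:
under 20395's own binders (`ClassO6 W 3`, `ρ̄₃` onto, `r_an = 1`, `K` Heegner for `N`, `κ` anticyclotomic,
`𝔭` of degree one, `𝔭′ ≠ 𝔭`, `ι′` inducing `𝔭`), every ♭-frame `Q ∈ 𝓞_{ℂ_3}⟦T⟧`
(`R1.IsBDPLFunctionInt 3 ι′ 𝔭 κ γ Dt.f Ω_K Ω_p Q`, periods non-zero) satisfies
`(Q) ⊆ Ch_Λ(X_ac(E/K_∞) strict at 𝔭′)·𝓞_{ℂ_3}⟦T⟧`. Then the `R₀` text of record holds at EVERY frame by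
§1 (`unrInclGe_of_flatInclGe'`; no control theorem, no torsion antecedent). The research content of the crux
is `hflat`, untouched. [folklore] [cite: Castella2018, §3 (arXiv:1704.06608 p. 9)]
[cite: Washington1997, §13.2] -/
theorem additiveSplitIMCInclusionAtThree_of_flat
    (hflat : ∀ (W : WeierstrassCurve ℚ) [W.IsElliptic] [W.IsGloballyMinimal] (N : ℕ) [NeZero N] (K : Type)
      [Field K] [NumberField K]
      (Dt : Literature.NumberTheory.EllipticCurves.ModularForms.ModularParametrizationData W N),
      Summit.BirchSwinnertonDyer.Rank1Residual.Additive.ClassO6 W 3 → W.HasSurjectiveModNGaloisRep 3 →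
      W.analyticRank = 1 → W.conductorNorm ℤ = N →
      Literature.NumberTheory.EllipticCurves.IsImaginaryQuadratic K →
      Literature.NumberTheory.EllipticCurves.SatisfiesHeegnerHypothesis N K →
      ∀ (κ : Literature.NumberTheory.EllipticCurves.ZpExtension K 3), κ.IsAnticyclotomic →
      ∀ (γ : Field.absoluteGaloisGroup K) [Fact (κ.IsTopGenerator γ)]
        (𝔭 : IsDedekindDomain.HeightOneSpectrum (NumberField.RingOfIntegers K)),
        ((3 : ℕ) : NumberField.RingOfIntegers K) ∈ 𝔭.asIdeal →
        𝔭.asIdeal.ramificationIdx (NumberField.RingOfIntegers ℚ) = 1 →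
        𝔭.asIdeal.inertiaDeg (NumberField.RingOfIntegers ℚ) = 1 →
      ∀ (𝔭' : IsDedekindDomain.HeightOneSpectrum (NumberField.RingOfIntegers K)),
        ((3 : ℕ) : NumberField.RingOfIntegers K) ∈ 𝔭'.asIdeal → 𝔭' ≠ 𝔭 →
      ∀ (ι' : PadicAlgCl 3 ≃+* ℂ),
        Summit.BirchSwinnertonDyer.BirchSwinnertonDyer.Theorems.SchneiderFree.BranchInducesPrime 3 ι' 𝔭 →
      ∀ (ΩK : ℂ) (Ωp : ℂ_[3]) (Q : PowerSeries (PadicComplexInt 3)), ΩK ≠ 0 → Ωp ≠ 0 →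
        Summit.BirchSwinnertonDyer.Rank1Residual.X11b.R1.IsBDPLFunctionInt 3 ι' 𝔭 κ γ Dt.f ΩK Ωp Q →
        Ideal.span {Q} ≤
          (Summit.BirchSwinnertonDyer.Rank1Residual.X11b.AcSelmer.XAc.charIdeal (W.baseChange K) 3 κ 𝔭' ∅ γ).map
            (PowerSeries.map (Summit.BirchSwinnertonDyer.Rank1Residual.X11b.R1.toCpInt 3))) :
    AdditiveSplitIMCInclusionAtThree := by
  intro W _ _ N _ K _ _ Dt hO6 hsurj hr1 hN hK hH κ hκ γ _ 𝔭 h𝔭 he hf 𝔭' h𝔭' hne ι' hι ΩK Ωp L hΩK hΩp hL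
  exact unrInclGe_of_flatInclGe' (p := 3) W κ 𝔭' ∅ γ
    (fun Q hQ ↦ hflat W N K Dt hO6 hsurj hr1 hN hK hH κ hκ γ 𝔭 h𝔭 he hf 𝔭' h𝔭' hne ι' hι ΩK Ωp Q hΩK hΩp hQ)
    L hL

/-- **The crux from the WEAKER-bindered ♭ text** of gen 2's TURNKEY (evidence #3 on 20395:
`ClassO5 W 3 ∨ ClassO6 W 3`, `ρ̄₃` IRREDUCIBLE, `r_an ≤ 1` — one text reading the onto AND the
irreducible-not-onto wild rank-one rows and the irreducible part of leaf #6's rank-zero habitat): it implies the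
stub (onto ⟹ irreducible; `= 1 ⟹ ≤ 1`; `ClassO6 ⟹ O5 ∨ O6`), hence the crux. [folklore]
[cite: Castella2018, §3 (arXiv:1704.06608 p. 9)] -/
theorem additiveSplitIMCInclusionAtThree_of_flat_weak
    (hflat : ∀ (W : WeierstrassCurve ℚ) [W.IsElliptic] [W.IsGloballyMinimal] (N : ℕ) [NeZero N] (K : Type)
      [Field K] [NumberField K]
      (Dt : Literature.NumberTheory.EllipticCurves.ModularForms.ModularParametrizationData W N),
      (Summit.BirchSwinnertonDyer.Rank1Residual.Additive.ClassO5 W 3 ∨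
        Summit.BirchSwinnertonDyer.Rank1Residual.Additive.ClassO6 W 3) →
      W.HasIrreducibleModPGaloisRep 3 → W.analyticRank ≤ 1 → W.conductorNorm ℤ = N →
      Literature.NumberTheory.EllipticCurves.IsImaginaryQuadratic K →
      Literature.NumberTheory.EllipticCurves.SatisfiesHeegnerHypothesis N K →
      ∀ (κ : Literature.NumberTheory.EllipticCurves.ZpExtension K 3), κ.IsAnticyclotomic →
      ∀ (γ : Field.absoluteGaloisGroup K) [Fact (κ.IsTopGenerator γ)]
        (𝔭 : IsDedekindDomain.HeightOneSpectrum (NumberField.RingOfIntegers K)),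
        ((3 : ℕ) : NumberField.RingOfIntegers K) ∈ 𝔭.asIdeal →
        𝔭.asIdeal.ramificationIdx (NumberField.RingOfIntegers ℚ) = 1 →
        𝔭.asIdeal.inertiaDeg (NumberField.RingOfIntegers ℚ) = 1 →
      ∀ (𝔭' : IsDedekindDomain.HeightOneSpectrum (NumberField.RingOfIntegers K)),
        ((3 : ℕ) : NumberField.RingOfIntegers K) ∈ 𝔭'.asIdeal → 𝔭' ≠ 𝔭 →
      ∀ (ι' : PadicAlgCl 3 ≃+* ℂ),
        Summit.BirchSwinnertonDyer.BirchSwinnertonDyer.Theorems.SchneiderFree.BranchInducesPrime 3 ι' 𝔭 →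
      ∀ (ΩK : ℂ) (Ωp : ℂ_[3]) (Q : PowerSeries (PadicComplexInt 3)), ΩK ≠ 0 → Ωp ≠ 0 →
        Summit.BirchSwinnertonDyer.Rank1Residual.X11b.R1.IsBDPLFunctionInt 3 ι' 𝔭 κ γ Dt.f ΩK Ωp Q →
        Ideal.span {Q} ≤
          (Summit.BirchSwinnertonDyer.Rank1Residual.X11b.AcSelmer.XAc.charIdeal (W.baseChange K) 3 κ 𝔭' ∅ γ).map
            (PowerSeries.map (Summit.BirchSwinnertonDyer.Rank1Residual.X11b.R1.toCpInt 3))) :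
    AdditiveSplitIMCInclusionAtThree := by
  refine additiveSplitIMCInclusionAtThree_of_flat ?_
  intro W _ _ N _ K _ _ Dt hO6 hsurj hr1 hN hK hH κ hκ γ _ 𝔭 h𝔭 he hf 𝔭' h𝔭' hne ι' hι ΩK Ωp Q hΩK hΩp hQ
  haveI : NeZero ((3 : ℕ) : ℚ) := ⟨by norm_num⟩
  exact hflat W N K Dt (Or.inr hO6)
    (hasIrreducibleModPGaloisRep_of_hasSurjectiveModNGaloisRep W 3 hsurj) hr1.le hN hK hH κ
    hκ γ 𝔭 h𝔭 he hf 𝔭' h𝔭' hne ι' hι ΩK Ωp Q hΩK hΩp hQ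

end Summit.BirchSwinnertonDyer.BirchSwinnertonDyer.Theorems.WildThreeInclusionKernel

end
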